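import Summits.BirchSwinnertonDyer.Rank1Residual.ManinAdditive.KummerDiamondShapeLaws
import Summits.BirchSwinnertonDyer.Rank1Residual.ManinAdditive.KummerDiamondLocalTwoAdic
import Summits.BirchSwinnertonDyer.BirchSwinnertonDyer.Theorems.ManinLocalTwoThreeCDivisionAssembly
import HarnessLib

/-!
# KUMMER–DIAMOND SHAPE LAWS ⟹ C2 modulo CDT — the route-cone composition (es g38, MEMO-es §59; sibling of `KummerDiamondShapeLaws.lean`)

The ONE theorem of es's Sketch-es-g38.lean f640306077cb1c09 that names the route declaration
`Theses.ManinLocalTwoThree.ManinOddAtFour` (C2, stmt-BirchSwinnertonDyer-22967): **`maninOddAtFour_of_CDT_shape_laws : CDT_algInt → E-es-185 → E-es-186 →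
ManinOddAtFour`**, VERBATIM, through the landed `CDivAssembly.maninOddAtFour_of_CDT_indexNeFour` (p754408) and the leaf's
`shimuraIndexNeFourAtFour_of_shape_laws`.  Kept out of the route-independent leaf because `…CDivisionAssembly` is inside the
`Theses.ManinLocalTwoThree` import cone (HOME/typer/README gotcha 96/118: «…Split.lean = deliberate cone leaf for theorems naming the route decl»).
CONDITIONAL implication only (hypotheses: the printed CDT Prop, and the two OPEN laws E-es-185 / E-es-186 — paper theorems pending ref1 R-es-87);
priced per the director's 00:56Z freeze.  BSD is not proved by this; Manin c = 1 not proved; C2 OPEN.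

TYPER NOTE (typer g21, T-es-72 sibling): theorem text verbatim from the sketch §3; same namespace `…ManinAdditive.KummerDiamond`; kind proof.
APPEND (typer g21, T-es-73): `maninOddAtFour_of_CDT_shape_local : CDT → exists_isNewformOf → E-es-185 → E-es-186♭ → ManinOddAtFour` VERBATIM from
HOME/es/g38/KummerDiamondLocalTwoAdic-es-g38.lean ea70b936f0206045 (MEMO-es §59.13), whose cone-free part is the leaf `KummerDiamondLocalTwoAdic.lean`
(now imported); C2 «⟸ CDT ∧ hnf ∧ 185 ∧ 186♭» — conditional implication only.
APPEND 2 (typer g21, T-es-73 rev 2 d65a2b1bbc25950e): `maninOddAtFour_of_CDT_shape_local'` — the same with `exists_isNewformOf` taken from C2's own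
fourth printed-fact binder (no separate modularity hypothesis): C2 «⟸ CDT ∧ 185 ∧ 186♭».
-/

set_option autoImplicit false

noncomputable section

open WeierstrassCurve Literature.NumberTheory.EllipticCurves Literature.NumberTheory.EllipticCurves.ModularForms
open Summit.BirchSwinnertonDyer.Rank1Residual.ManinAdditive.ShimuraKernel

namespace Summit.BirchSwinnertonDyer.Rank1Residual.ManinAdditive.KummerDiamond

/-- **C2 ⟸ CDT ∧ E-es-185 ∧ E-es-186** (through the landed `CDivAssembly.maninOddAtFour_of_CDT_indexNeFour`). -/
theorem maninOddAtFour_of_CDT_shape_laws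
    (hCDT : Literature.NumberTheory.Automorphic.CalegariDimitrovTang2025_unboundedDenominators_algInt)
    (h185 : IndexFourForcesFreyTwistShape) (h186 : FreyTwistShapeTwoAdicLaw) :
    Summit.BirchSwinnertonDyer.BirchSwinnertonDyer.Theses.ManinLocalTwoThree.ManinOddAtFour :=
  Summit.BirchSwinnertonDyer.BirchSwinnertonDyer.Theorems.ManinLocalTwoThree.CDivAssembly.maninOddAtFour_of_CDT_indexNeFour
    hCDT (shimuraIndexNeFourAtFour_of_shape_laws h185 h186)

/-- **C2 ⟸ CDT ∧ modularity ∧ E-es-185 ∧ E-es-186♭** — only the Kummer–diamond exclusion E-es-185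
and the local Tate computation 186♭ remain (plus the cell-standard CDT and modularity facts). -/
theorem maninOddAtFour_of_CDT_shape_local
    (hCDT : Literature.NumberTheory.Automorphic.CalegariDimitrovTang2025_unboundedDenominators_algInt)
    (hnf : exists_isNewformOf)
    (h185 : IndexFourForcesFreyTwistShape) (h186loc : FreyTwistShapeConductorExponentTwoLaw) :
    Summit.BirchSwinnertonDyer.BirchSwinnertonDyer.Theses.ManinLocalTwoThree.ManinOddAtFour :=
  maninOddAtFour_of_CDT_shape_laws hCDT h185 (freyTwistShapeTwoAdicLaw_of_local h186loc hnf)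


/-- **C2 ⟸ CDT ∧ E-es-185 ∧ E-es-186♭** — the modularity hypothesis `exists_isNewformOf` is taken from
the C2 statement itself (its fourth printed-fact binder), so no extra hypothesis remains. -/
theorem maninOddAtFour_of_CDT_shape_local'
    (hCDT : Literature.NumberTheory.Automorphic.CalegariDimitrovTang2025_unboundedDenominators_algInt)
    (h185 : IndexFourForcesFreyTwistShape) (h186loc : FreyTwistShapeConductorExponentTwoLaw) :
    Summit.BirchSwinnertonDyer.BirchSwinnertonDyer.Theses.ManinLocalTwoThree.ManinOddAtFour := by
  intro hM hAU hC hnf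
  exact maninOddAtFour_of_CDT_shape_laws hCDT h185 (freyTwistShapeTwoAdicLaw_of_local h186loc hnf) hM hAU hC hnf


end Summit.BirchSwinnertonDyer.Rank1Residual.ManinAdditive.KummerDiamond

end
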